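import Summits.Ventures.DiscreteObjects.PP12.FlagSubcells

/-!
# PP(12), flag sub-cell `f = 7`: the ORBIT MATRIX as a typed finite statement (matrix form)
Framing: lottery ticket; floor = certified bounds/negative ranges.

Cell pub-namedobj (venture DiscreteObjects), target (M), designs gen 13; sibling of `FlagTenOrbitMatrix` (designs g12, `f = 10`).
A flag-type collineation `σ` (`σ³ = 1`, `σ ≠ 1`) of a projective plane of order 12 with exactly 7 fixed points `c, y₀, …, y₅ ∈ l`
(fixed lines `l, m₀, …, m₅ ∋ c`) has `ρ = 2` orbits `Γ₀, Γ₁` of non-fixed lines through `c`, two orbits `Z₀, Z₁` of non-fixed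
points on `l`, `2·12` exterior orbit-triangles `(s,i)` (`s` = the c-line orbit carrying the vertices, `i : Fin 12`), `6·4` orbits
`(j,t)` of non-fixed points on the `m_j`, and dually `2·12` side orbits and `6·4` orbits `(k,t)` of non-fixed lines through the `y_k`
(designs g12 FAMILY-FLAG7 §0–§1, §3). Its `57 × 57` orbit matrix is determined by the finite data `FlagSevenOrbitData`
(`κ, ψ, R, γ` for the side rows; `C, β` for the T-line rows), and `IsFlagSevenOrbitMatrix` is the COMPLETE `λ = 1` system of
that matrix over the 50 non-fixed rows and columns — every pair of rows (incl. a row with itself) and every pair of columns has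
the inner product forced by 'two lines meet in one point / two points lie on one line' summed over `σ`-orbits (the fixed rows
and columns `c, y_k, l, m_j` are eliminated; their contributions are the constants in `rowTarget` / `colTarget`).
This is exactly the constraint model of designs g13's orbit-matrix completer (HOME FAMILY-FLAG7X §1), which was VALIDATED on
the orbit data extracted from genuine planes one order down (Hughes(9) and Hall(9), `f = 4`, `ρ = 2`: the same shapes with
`n = 9`) and is equivalent to FAMILY-FLAG7 §1 (R1)–(C6). As for `f = 10`, the REDUCTION `FlagSevenOrbitReduction` (plane ⇒ data)
is TYPED, not proved (the orbit indexing is not formalised; the analytic ingredient, the plane-level orbit identity, is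
`OrbitCountOrderThree.orbit_row_identity`), and `noFlagSeven_of_orbitReduction` records the pure-logic bridge to the census
statement `NoFlagOrder3Order12Fixed 7`.

CENSUS STATUS (2026-08-22, outside the kernel): `NoFlagSevenOrbitMatrix` is UNDECIDED — enumeration sized beyond bound k
(designs g12 FAMILY-FLAG7 §7, §9), randomized existence search inconclusive, one symmetric ansatz empty by counting (designs g13
FAMILY-FLAG7X). Nothing in this file depends on any computation. No `sorry`, no new axioms.
-/

namespace Summit.Ventures.DiscreteObjects.PP12

open Configuration Finset
open scoped Classical

/-- Row index of the non-fixed part of the `f = 7` orbit matrix: c-line orbit `Γ_s` | side orbit of triangle `(s,i)` |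
T-line orbit `(k,t)` through the fixed point `y_k`. -/
abbrev F7Row := Fin 2 ⊕ (Fin 2 × Fin 12) ⊕ (Fin 6 × Fin 4)

/-- Column index of the non-fixed part: l-orbit `Z_t` | exterior triangle `(s,i)` | T-point orbit `(j,t)` on the fixed line `m_j`. -/
abbrev F7Col := Fin 2 ⊕ (Fin 2 × Fin 12) ⊕ (Fin 6 × Fin 4)

/-- The finite data of the `f = 7` orbit matrix (FAMILY-FLAG7 §1/§3): for the side orbit of triangle `(s,i)` — the l-orbit
`κ s i` its sides pass through, the triangle `ψ s i` (same c-line orbit) of its odd point, the set `R s i` of the three triangles of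
the OTHER c-line orbit met by a side, and `γ s i j` = the orbit on `m_j` met by the sides; for the T-line orbit `(k,t)` — the sets
`C k t s` of the three triangles of `Γ_s` whose vertices it contains and `β k t j` = the orbit on `m_j` it meets. -/
structure FlagSevenOrbitData where
  /-- l-orbit of the sides of triangle `(s,i)` -/
  κ : Fin 2 → Fin 12 → Fin 2
  /-- odd-point triangle of `(s,i)` (in the same c-line orbit) -/
  ψ : Fin 2 → Fin 12 → Fin 12
  /-- the three triangles of the other c-line orbit met by a side of `(s,i)` -/
  R : Fin 2 → Fin 12 → Finset (Fin 12)
  /-- `γ s i j` = orbit on `m_j` met by the sides of `(s,i)` -/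
  γ : Fin 2 → Fin 12 → Fin 6 → Fin 4
  /-- `C k t s` = the three triangles of `Γ_s` on the T-line orbit `(k,t)` -/
  C : Fin 6 → Fin 4 → Fin 2 → Finset (Fin 12)
  /-- `β k t j` = orbit on `m_j` met by the T-line orbit `(k,t)` -/
  β : Fin 6 → Fin 4 → Fin 6 → Fin 4

namespace FlagSevenOrbitData

variable (D : FlagSevenOrbitData)

/-- `0/1` indicator (local helper). -/
noncomputable def ind (p : Prop) : ℕ := if p then 1 else 0

/-- The entries of the non-fixed `50 × 50` block of the orbit matrix: number of points of the column orbit on ONE line of the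
row orbit. -/
noncomputable def entry : F7Row → F7Col → ℕ
  | Sum.inl s, Sum.inr (Sum.inl (s', _)) => ind (s' = s)                      -- a c-line of Γ_s carries one vertex of each triangle of Γ_s
  | Sum.inl _, _ => 0
  | Sum.inr (Sum.inl (s, i)), Sum.inl t => ind (D.κ s i = t)                   -- a side meets l in a point of Z_κ
  | Sum.inr (Sum.inl (s, i)), Sum.inr (Sum.inl (s', i')) =>
      if s' = s then 2 * ind (i' = i) + ind (i' = D.ψ s i) else ind (i' ∈ D.R s i)
  | Sum.inr (Sum.inl (s, i)), Sum.inr (Sum.inr (j, t)) => ind (D.γ s i j = t)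
  | Sum.inr (Sum.inr _), Sum.inl _ => 0                                        -- a T-line meets l in the fixed point y_k
  | Sum.inr (Sum.inr (k, t)), Sum.inr (Sum.inl (s, i)) => ind (i ∈ D.C k t s)
  | Sum.inr (Sum.inr (k, t)), Sum.inr (Sum.inr (j, t')) => ind (D.β k t j = t')

/-- Forced inner products of two rows over the non-fixed columns (`λ = 1` summed over the second orbit, minus the fixed
columns): a row with itself `n + 3 = 15` minus `3·#(fixed points on the line)` (`Γ`: `c`; T-line: `y_k`); two distinct rows `3`,
except `0` for `Γ₀·Γ₁` (common fixed point `c`) and for two T-line orbits through the same `y_k`. -/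
def rowTarget : F7Row → F7Row → ℕ
  | Sum.inl s, Sum.inl s' => if s = s' then 12 else 0
  | Sum.inr (Sum.inl x), Sum.inr (Sum.inl x') => if x = x' then 15 else 3
  | Sum.inr (Sum.inr (k, t)), Sum.inr (Sum.inr (k', t')) => if (k, t) = (k', t') then 12 else if k = k' then 0 else 3
  | _, _ => 3

/-- Forced inner products of two columns over the non-fixed rows (dually): a column with itself `15` minus `3·#(fixed lines
through the point)` (`Z_t ⊂ l`; `(j,t) ⊂ m_j`); two distinct columns `3`, except `0` for `Z₀·Z₁` (both on `l`) and for two orbits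
on the same `m_j`. -/
def colTarget : F7Col → F7Col → ℕ
  | Sum.inl t, Sum.inl t' => if t = t' then 12 else 0
  | Sum.inr (Sum.inl x), Sum.inr (Sum.inl x') => if x = x' then 15 else 3
  | Sum.inr (Sum.inr (j, t)), Sum.inr (Sum.inr (j', t')) => if (j, t) = (j', t') then 12 else if j = j' then 0 else 3
  | _, _ => 3

end FlagSevenOrbitData

/-- **The orbit-matrix equations of the `f = 7` flag sub-cell** (complete `λ = 1` system, matrix form): shapes (`ψ` has no fixed
point, `R` has three elements, the T-line orbits through each `y_k` partition every `Γ_s` into triples, `β k · j` is a bijection of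
the four orbits on `m_j`), all row inner products and all column inner products as forced (see `rowTarget`, `colTarget`). -/
def IsFlagSevenOrbitMatrix (D : FlagSevenOrbitData) : Prop :=
  (∀ s i, D.ψ s i ≠ i) ∧
  (∀ s i, (D.R s i).card = 3) ∧
  (∀ k t s, (D.C k t s).card = 3) ∧
  (∀ k s i, (univ.filter fun t => i ∈ D.C k t s).card = 1) ∧
  (∀ k j, Function.Bijective fun t => D.β k t j) ∧
  (∀ r r' : F7Row, ∑ c : F7Col, D.entry r c * D.entry r' c = FlagSevenOrbitData.rowTarget r r') ∧
  (∀ c c' : F7Col, ∑ r : F7Row, D.entry r c * D.entry r c' = FlagSevenOrbitData.colTarget c c')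

/-- **Census statement at the orbit level (typed; UNDECIDED as of 2026-08-22):** no orbit matrix of the `f = 7` flag sub-cell exists. -/
def NoFlagSevenOrbitMatrix : Prop := ∀ D : FlagSevenOrbitData, ¬ IsFlagSevenOrbitMatrix D

/-- **Census statement (typed, NOT proved): the orbit-matrix reduction of the `f = 7` flag sub-cell.** Every projective plane of
order 12 with a collineation `σ ≠ 1`, `σ³ = 1`, of flag type with exactly 7 fixed points yields data satisfying
`IsFlagSevenOrbitMatrix` (index the two c-line orbits, the triangles of each by `Fin 12`, the fixed points `≠ c` / fixed lines `≠ l`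
by `Fin 6`, the four non-trivial orbits on each `m_j` / through each `y_k` by `Fin 4`, and read off the tactical decomposition; every
equation is an instance of `OrbitCountOrderThree.orbit_row_identity` / `orbit_column_identity` grouped by orbits). -/
def FlagSevenOrbitReduction : Prop :=
  ∀ (P L : Type) [Membership P L] [Fintype P] [Fintype L] [ProjectivePlane P L],
    ProjectivePlane.order P L = 12 → ∀ σ : Collineation P L, σ.onPoints ^ 3 = 1 → σ.onPoints ≠ 1 →
      (∃ (l : L) (c : P), σ.onLines l = l ∧ σ.onPoints c = c ∧ c ∈ l ∧
          (∀ p : P, σ.onPoints p = p → p ∈ l) ∧ (∀ m : L, σ.onLines m = m → c ∈ m) ∧ fixedCard σ.onPoints = 7) →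
      ∃ D : FlagSevenOrbitData, IsFlagSevenOrbitMatrix D

/-- **How the census uses the orbit level:** if the reduction holds and no orbit matrix exists, the sub-cell `f = 7` is empty
(`NoFlagOrder3Order12Fixed 7`). Pure logic. -/
theorem noFlagSeven_of_orbitReduction (hred : FlagSevenOrbitReduction) (hno : NoFlagSevenOrbitMatrix) :
    NoFlagOrder3Order12Fixed 7 := by
  intro P L _ _ _ _ h12 σ hq hne hflag
  obtain ⟨D, hD⟩ := hred P L h12 σ hq hne hflag
  exact hno D hD

/-- Sanity of the encoding: under `IsFlagSevenOrbitMatrix` the two c-line orbit rows are orthogonal over the non-fixed columns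
(they share only the fixed point `c`), read off from the row system. -/
theorem IsFlagSevenOrbitMatrix.gamma_rows_orthogonal {D : FlagSevenOrbitData} (h : IsFlagSevenOrbitMatrix D) :
    ∑ c : F7Col, D.entry (Sum.inl 0) c * D.entry (Sum.inl 1) c = 0 := by
  rw [h.2.2.2.2.2.1 (Sum.inl 0) (Sum.inl 1)]; decide

/-- Sanity of the encoding: a side row has norm `15 = n + 3` (no fixed point on a side). -/
theorem IsFlagSevenOrbitMatrix.side_row_norm {D : FlagSevenOrbitData} (h : IsFlagSevenOrbitMatrix D) (s : Fin 2) (i : Fin 12) :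
    ∑ c : F7Col, D.entry (Sum.inr (Sum.inl (s, i))) c * D.entry (Sum.inr (Sum.inl (s, i))) c = 15 := by
  rw [h.2.2.2.2.2.1 (Sum.inr (Sum.inl (s, i))) (Sum.inr (Sum.inl (s, i)))]; simp [FlagSevenOrbitData.rowTarget]

end Summit.Ventures.DiscreteObjects.PP12
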